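import Summits.CriticalPhenomena.CardyFormulaZ2.Theorems.CardyComplexConeParafermionToSLESixFamiliesIicTouchAudit
import Literature.Probability.Percolation.InequalitiesProofs
import HarnessLib

/-!
# Touch probabilities of neighbouring sites are comparable: `P(x ↔ A) ≤ 2 · P(y ↔ A)` across a fair-coin edge
# (line `potential-darboux-picard-diamond`, S1″ clause (LOW): the second touch layer)

Crux `ParafermionToSLESixFamilies` (stmt-CriticalPhenomena-11389), line `potential-darboux-picard-diamond`, stub
`stub_exactPotentialTracePh2` (S1″). Clause (LOW) compares the renormalised TOUCH MASS of a free side — the sum of the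
touch probabilities `touchProb E x = P(x ↔ A)` over ALL touch sites near the segment, i.e. over the first two interior
layers of the two-layer staircase — with the progress of the face potential along the chain, which is `√3` times the sum
over the FIRST interior layer only (`exactPair_chainSum_touchProb`). The second layer is dominated by the first through
its lattice neighbours: this file proves the comparison

* `touchProb_le_two_mul_of_adj` (registered, `--supports` the crux) — for an edge `{x, y}` of `Ω_δ` with neither
  endpoint on the dual-wired arc `B`, `touchProb E x ≤ 2 · touchProb E y`.

Proof: `{x ↔ A} ∩ {xy open in ω} ⊆ {y ↔ A}` (such an edge is open in the completed configuration as soon as it is open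
in `ω`, `mem_bcBondConfig_iff`), both events are increasing and measurable (`isUpperSet_touchEvent`,
`measurableSet_touchEvent`), so Harris's inequality (`harris_fkg_holds`, Grimmett 1999 Thm. 2.4, proved in the tree) and
`P(xy open) = 1/2` (`bondPercolation_cylinder`) give `P(x ↔ A)/2 ≤ P(y ↔ A)`.
-/

noncomputable section

namespace Summit.CriticalPhenomena.CardyFormulaZ2.Cruxes.ParafermionToSLESixFamilies.PotentialDarbouxPicardDiamond

open MeasureTheory Set
open Literature.Probability Literature.Probability.LatticeModels Literature.Probability.Percolation
open Literature.Probability.LatticeModels.DiscreteDobrushin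
open Summit.CriticalPhenomena.CardyFormulaZ2.Cruxes.ParafermionToSLESixFamilies.IicTraceFluxPairing

/-- **Touch probabilities across a fair-coin edge** (registered helper of `stub_exactPotentialTracePh2`): for an edge
`{x, y}` of the discrete domain `Ω_δ` of `E` with neither endpoint on the dual-wired arc `B`,
`touchProb E x ≤ 2 · touchProb E y`. -/
theorem touchProb_le_two_mul_of_adj : ∀ (E : DiscreteDobrushin) (x y : Site 2), (discreteDomainGraph E.Ω E.δ).Adj x y → x ∉ E.zdArcB → y ∉ E.zdArcB → touchProb E x ≤ 2 * touchProb E y := by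
  intro E x y hadj hxB hyB
  set μ := bondPercolation (zdGraph 2) half with hμ
  set Tx : Set (BondConfig (Site 2)) := {ω | ∃ a ∈ E.zdArcA, (openGraph (E.bcBondConfig ω)).Reachable x a} with hTx
  set Ty : Set (BondConfig (Site 2)) := {ω | ∃ a ∈ E.zdArcA, (openGraph (E.bcBondConfig ω)).Reachable y a} with hTy
  set O : Set (BondConfig (Site 2)) := {ω | s(x, y) ∈ ω} with hO
  have he : s(x, y) ∈ (discreteDomainGraph E.Ω E.δ).edgeSet := (SimpleGraph.mem_edgeSet _).2 hadj
  have hez : s(x, y) ∈ (zdGraph 2).edgeSet :=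
    (SimpleGraph.mem_edgeSet _).2 (meshGraph_le_zdGraph _ _ (discreteDomainGraph_le_meshGraph _ _ hadj))
  -- `{x ↔ A} ∩ {xy open} ⊆ {y ↔ A}`
  have hsub : Tx ∩ O ⊆ Ty := by
    rintro ω ⟨⟨a, ha, hreach⟩, hω⟩
    have hbc : s(x, y) ∈ E.bcBondConfig ω := by
      rw [mem_bcBondConfig_iff]
      refine ⟨he, Or.inr ⟨hω, fun z hz => ?_⟩⟩
      rcases Sym2.mem_iff.1 hz with rfl | rfl
      · exact hxB
      · exact hyB
    have hyx : (openGraph (E.bcBondConfig ω)).Adj y x := by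
      rw [openGraph_adj, Sym2.eq_swap]
      exact ⟨hbc, hadj.ne.symm⟩
    exact ⟨a, ha, hyx.reachable.trans hreach⟩
  -- Harris
  have hH := harris_fkg_holds (zdGraph 2) half (isUpperSet_touchEvent (E := E) (x := x))
    (fun _ _ h he => h he : IsUpperSet O) (measurableSet_touchEvent (E := E) (x := x)) (measurableSet_mem _)
  have hOhalf : μ.real O = 1 / 2 := by rw [hμ, hO, bondPercolation_cylinder (zdGraph 2) half hez]; rfl
  have hmono : μ.real (Tx ∩ O) ≤ μ.real Ty := measureReal_mono hsub
  change μ.real Tx ≤ 2 * μ.real Ty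
  rw [hOhalf] at hH
  linarith

end Summit.CriticalPhenomena.CardyFormulaZ2.Cruxes.ParafermionToSLESixFamilies.PotentialDarbouxPicardDiamond

end
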